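import Summits.AnomalousDissipation.AnomalousDissipation.Theses.QuarticLadder
import Summits.AnomalousDissipation.AnomalousDissipation.Theses.MomentParity
import Summits.AnomalousDissipation.AnomalousDissipation.Theorems.MomentParityMomentClosure

/-!
# Line `repoint` for crux `QuarticLadder.MomentClosure` (stmt-AnomalousDissipation-15063)
# — TRANSFER from the solved sibling `MomentParity.MomentClosure`, sorry-free

Crux-strategist line (unit `cstrat-stmt-AnomalousDissipation-15063-b1`, 2026-08-17). The crux is
FIXED: `Summit.AnomalousDissipation.AnomalousDissipation.Theses.QuarticLadder.MomentClosure` — closure in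
the moment order `d` at fixed `(f, ν, N, E, ε, R, κ)` (loud `d`-stationary level-`N` measures for every
`d`, common support ball and tail schedule ⟹ one loud Galerkin-invariant measure with the same bounds).

## The lens with teeth: TRANSFER (identity dictionary)

Route `QuarticLadder` is the D-0019 split of route `MomentParity` and re-asks its statements VERBATIM
(route header, § Thesis). The sibling's version of exactly this step is the item
stmt-AnomalousDissipation-11467 `Theses.MomentParity.MomentClosure`, PROVED in tree:
`Summit.AnomalousDissipation.AnomalousDissipation.Theorems.momentClosure_proof`
(`Theorems/MomentParityMomentClosure.lean`: 1. compact carrier `{u level-N, ‖u‖ ≤ R}`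
(`isCompact_levelBall`); 2. weak-* limit measure (`exists_limit_measure_of_isCompact`); 3. closed rows
(energy, band enstrophies/tail schedule via `tail_iff`, dissipation floor, every polynomial generator
row eventually in `d`); 4. `C¹`-Weierstrass upgrade (`integral_nsGeneratorPairing_grad_eq_zero`,
`Literature.Topology.FourManifolds.exists_mvPolynomial_close_C1`)).
The dictionary is the identity: the two `def`s have syntactically identical bodies over the same
Literature declarations, hence are definitionally equal (`twin_rfl` below, by `rfl`), and the
transferring argument breaks NOWHERE — the landed theorem closes the crux by `exact`.

## Shape of this skeleton

ZERO stubs: the composition `MomentClosure_of` concluding the crux BY NAME is a complete proof (no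
`sorry`, standard axioms). `ledger skeleton check` therefore registers no stubs and leaves the sibling
line `Lines/birth.lean` (stubs `stub_polyStationaryLimit`, `stub_cylindricalUpgrade` — the two-piece
anatomy of the same landed proof, to be RE-proved) untouched as the item's registered skeleton; this
line dominates it (0 open stubs versus 2 of size M/L) and is the one a prover should land.

## PROVER ACTION (one propose, no cycles)

`Summits/…/Theorems` is prover-only at the gate (D-0016: this seat's `ledger propose --dry-run` of the
same text bounced `perm.theorems-prover-only`), so the row stays open until ANY prover lands the body of
this file as `Summits/AnomalousDissipation/AnomalousDissipation/Theorems/QuarticLadderMomentClosure.lean`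
(ready-to-land copy attached as item evidence `QuarticLadderMomentClosure.lean`, farm `lean check`
rc 0, 0 sorries, audit `proof-of-item closed: true`) with
`ledger propose --kind proof --target Summits/AnomalousDissipation/AnomalousDissipation/Theorems/QuarticLadderMomentClosure.lean --file … --workitem stmt-AnomalousDissipation-15063`.
The route file `Theses/QuarticLadder.lean` is NOT touched and keeps its rev-3 import cone (it does not
import any `Theorems.MomentParityMomentClosure*` module; only this proof file does, exactly as the
sibling's proof file).

Disproof used: `Cruxes/MomentClosure/Disproof.lean` (refuter-rattack-stmt-AnomalousDissipation-15063-0,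
published 2026-08-17T08:48Z, read at the publication boundary of this line): its verdict is the same —
"NO KILL POSSIBLE — the crux is a THEOREM of the tree" (`Disproof.momentClosure_holds :=
Theorems.momentClosure_proof`, the very term of `MomentClosure_of` below; `example : MomentClosure =
MomentParity.MomentClosure := rfl` = `twin_rfl`). Obstruction honoured:
`Disproof.momentClosure_false_without_ladder` (the ladder hypothesis `∀ d, ∃ μ_d …` is load-bearing:
at `R = -1` the conclusion is false) — this line USES the ladder hypothesis, consumed inside
`momentClosure_proof` (`choose μ … using hd`; the support radius `R ≥ 0` and the limit measure come from
the `μ_d`). Mutation noted, not needed: `Disproof.momentClosureStrong_holds` (the hypotheses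
`IsDivFree f`, `HasZeroMean f`, `0 < ν` are unnecessary). Targets broken: none (the disprover checked
`birth`'s two stubs against the landed lemmas). Near-misses: none. Negatives honoured: the 6 refuted
AnomalousDissipation statements concern other families; a proved statement cannot meet them.
-/

-- `Summit.<Summit>.<Problem>` is the tree's mandated summit-side namespace (CONVENTIONS §2); for this
-- single-conjunct summit the two coincide, so the duplicate is deliberate.
set_option linter.dupNamespace false

namespace Summit.AnomalousDissipation.AnomalousDissipation.Cruxes.MomentClosure.Repoint

open Summit.AnomalousDissipation.AnomalousDissipation

/-- The dictionary of the transfer is the identity: the QuarticLadder crux and the MomentParity crux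
are the same proposition, definitionally (identical bodies over identical declarations). -/
theorem twin_rfl : Theses.QuarticLadder.MomentClosure = Theses.MomentParity.MomentClosure := rfl

/-- Transfer step (the only step of the line): the sibling's crux implies this crux — definitional
transport along `twin_rfl`. -/
theorem MomentClosure_of_sibling :
    Theses.MomentParity.MomentClosure → Theses.QuarticLadder.MomentClosure := fun h => Eq.mpr twin_rfl h

/-- **Composition concluding the crux BY NAME, sorry-free**: `QuarticLadder.MomentClosure` holds, by the
landed sibling theorem `Theorems.momentClosure_proof` (stmt-AnomalousDissipation-11467). This is the
whole line; a prover lands this term as `Theorems/QuarticLadderMomentClosure.lean` with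
`--workitem stmt-AnomalousDissipation-15063`. -/
theorem MomentClosure_of : Theses.QuarticLadder.MomentClosure :=
  MomentClosure_of_sibling Theorems.momentClosure_proof

end Summit.AnomalousDissipation.AnomalousDissipation.Cruxes.MomentClosure.Repoint
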